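import Mathlib
import Literature.NumberTheory.Automorphic.ReciprocityGLn
import Literature.NumberTheory.GaloisRepresentations.FramedRepBaseChange
import HarnessLib

/-!
# Stub `stub_charpolyDictionary` for the line `Sketch` of the crux `ArtinWeightRealisationLevel`

The `2 × 2` dictionary between the summit's normalisation of Satake–Frobenius compatibility
(`charpoly M = ∏_{a ∈ α} (X - ι⁻¹(a⁻¹))`, i.e. `arithFrobPolyOfSatake ι q 1 α`) and Tunnell's
(`charpoly (ι((M⁻¹)ᵀ)) = ∏_{a ∈ α} (X - a)`, i.e. `satakePolynomial α`), for `M ∈ GL₂(ℚ̄_p)`,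
`ι : ℚ̄_p ≃+* ℂ` and a multiset `α` of two complex numbers.  Pure linear algebra of `2 × 2`
matrices over a field: `charpoly_inv_of_charpoly_eq_fin_two` (`X² - aX + d ↦ X² - (a/d)X + d⁻¹`),
`Matrix.charpoly_map`, `Matrix.charpoly_transpose`, and injectivity of `Polynomial.map ι`.
-/

set_option linter.dupNamespace false -- Summit.Langlands.Langlands is the mandated namespace (D-0017)

noncomputable section

open scoped MatrixGroups Matrix Polynomial
open Literature.NumberTheory.Automorphic Literature.NumberTheory.GaloisRepresentations Polynomial

namespace Summit.Langlands.Langlands.Theorems.ArtinWeightRealisationLevel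

/-- Two linear factors multiply out to `X² - C (x + y) X + C (x y)` (Vieta in degree `2`).
[folklore] -/
private theorem X_sub_C_mul_X_sub_C {F : Type*} [CommRing F] (x y : F) :
    (X - C x) * (X - C y) = X ^ 2 - C (x + y) * X + C (x * y) := by
  simp only [C_add, C_mul]
  ring

/-- For an invertible `2 × 2` matrix `N` over a field: if `charpoly N = (X - x)(X - y)` then
`charpoly N⁻¹ = (X - x⁻¹)(X - y⁻¹)` (`det N = x y ≠ 0` forces `x ≠ 0` and `y ≠ 0`, and then
`(x + y)/(x y) = x⁻¹ + y⁻¹`, `(x y)⁻¹ = x⁻¹ y⁻¹`; `charpoly_inv_of_charpoly_eq_fin_two`). [folklore] -/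
private theorem charpoly_inv_eq_of_charpoly_eq {F : Type*} [Field F] {N : Matrix (Fin 2) (Fin 2) F}
    (hN : IsUnit N.det) {x y : F} (h : N.charpoly = (X - C x) * (X - C y)) :
    N⁻¹.charpoly = (X - C x⁻¹) * (X - C y⁻¹) := by
  rw [X_sub_C_mul_X_sub_C] at h
  have hdet : N.det = x * y := by
    have h' := h
    rw [Matrix.charpoly_fin_two] at h'
    have h0 := congrArg (fun p : F[X] => p.coeff 0) h'
    simpa using h0
  have hx : x ≠ 0 := fun hx => hN.ne_zero (by rw [hdet, hx, zero_mul])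
  have hy : y ≠ 0 := fun hy => hN.ne_zero (by rw [hdet, hy, mul_zero])
  have hsum : (x + y) / (x * y) = x⁻¹ + y⁻¹ := by
    field_simp
    ring
  rw [charpoly_inv_of_charpoly_eq_fin_two h, X_sub_C_mul_X_sub_C, mul_inv, hsum]

/-- **The `2 × 2` dictionary between the summit's and Tunnell's normalisations.**
For an invertible `M ∈ GL₂(ℚ̄_p)`, `ι : ℚ̄_p ≃+* ℂ` and a multiset `α` of two complex numbers:
`charpoly M = ∏_{a ∈ α} (X - ι⁻¹(a⁻¹))` (`arithFrobPolyOfSatake ι q 1 α`) iff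
`charpoly (ι((M⁻¹)ᵀ)) = ∏_{a ∈ α} (X - a)` (`satakePolynomial α`).  Write `α = {a, b}`; the
transpose does not change the characteristic polynomial, mapping by `ι` is undone by injectivity
of `Polynomial.map ι`, and with `a' = ι⁻¹ a`, `b' = ι⁻¹ b` the claim is
`charpoly M = (X - a'⁻¹)(X - b'⁻¹) ↔ charpoly M⁻¹ = (X - a')(X - b')`, both directions being
`charpoly_inv_eq_of_charpoly_eq` (for `M`, resp. for `M⁻¹` with `M⁻¹⁻¹ = M`). [folklore] -/
theorem stub_charpolyDictionary {p : ℕ} [Fact p.Prime] (ι : PadicAlgCl p ≃+* ℂ) (q : ℕ)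
    (M : GL (Fin 2) (PadicAlgCl p)) (α : Multiset ℂ) (hα : Multiset.card α = 2) :
    (M : Matrix (Fin 2) (Fin 2) (PadicAlgCl p)).charpoly = arithFrobPolyOfSatake ι q 1 α ↔
      ((((M⁻¹ : GL (Fin 2) (PadicAlgCl p)) : Matrix (Fin 2) (Fin 2) (PadicAlgCl p))ᵀ).map
          (ι : PadicAlgCl p → ℂ)).charpoly = satakePolynomial α := by
  obtain ⟨a, b, rfl⟩ := Multiset.card_eq_two.mp hα
  have hL : arithFrobPolyOfSatake ι q 1 {a, b} =
      (X - C (ι.symm a)⁻¹) * (X - C (ι.symm b)⁻¹) := by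
    rw [arithFrobPolyOfSatake_one, Multiset.insert_eq_cons, Multiset.map_cons,
      Multiset.map_singleton, Multiset.prod_cons, Multiset.prod_singleton, map_inv₀ ι.symm a,
      map_inv₀ ι.symm b]
  have hR : satakePolynomial {a, b} =
      ((X - C (ι.symm a)) * (X - C (ι.symm b))).map ι.toRingHom := by
    rw [satakePolynomial, Multiset.insert_eq_cons, Multiset.map_cons, Multiset.map_singleton,
      Multiset.prod_cons, Multiset.prod_singleton, Polynomial.map_mul, Polynomial.map_sub,
      Polynomial.map_sub, map_X, map_C, map_C]
    simp
  have hmap : (((M⁻¹ : GL (Fin 2) (PadicAlgCl p)) : Matrix (Fin 2) (Fin 2) (PadicAlgCl p))ᵀ).map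
      (ι : PadicAlgCl p → ℂ) =
        (((M : Matrix (Fin 2) (Fin 2) (PadicAlgCl p))⁻¹)ᵀ).map ι.toRingHom := by
    rw [Matrix.coe_units_inv]
    rfl
  have hdet : IsUnit (M : Matrix (Fin 2) (Fin 2) (PadicAlgCl p)).det := Matrix.isUnits_det_units M
  rw [hmap, Matrix.charpoly_map, Matrix.charpoly_transpose, hL, hR,
    (Polynomial.map_injective _ ι.toRingHom.injective).eq_iff]
  constructor
  · intro h
    simpa only [inv_inv] using charpoly_inv_eq_of_charpoly_eq hdet h
  · intro h
    have h' := charpoly_inv_eq_of_charpoly_eq (Matrix.isUnit_nonsing_inv_det_iff.mpr hdet) h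
    rwa [Matrix.nonsing_inv_nonsing_inv _ hdet] at h'

end Summit.Langlands.Langlands.Theorems.ArtinWeightRealisationLevel

end
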